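import Mathlib
import Summits.ValiantsHypothesis.ValiantsHypothesis.Theorems.RigidityForcesSymmetryRankRigidMinimalReprLaplaceFiveStarFibreInputs

/-!
# ValiantsHypothesis / RigidityForcesSymmetry — crux `LaplaceOptimalFive` (stmt-ValiantsHypothesis-24813), crux idea
`young-shadow` (K1): **K1 ON THE STAR — THE MAIN CASE `star_main`** (labelled star, three two-term fibres, `|T| ≤ 9`)
(memo `NOTE-p4g15-24813-K1-star.md` §5; memo `NOTE-p4g16-24813-LemmaK-kernel.md`)

Wiring of the landed bricks: ✓ `star_letter_reading` → ✓ `star_slack_sum` (`Σ_j H_j = P₅ + 4E`) → ✓ `two_term_engine` on each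
two-term fibre: closed product ⇒ ✓ `weight_of_closed_product`; T2 ⇒ ✓ `slack_annihilated_of_binary` + ✓ `relations_kill_pattern_of_binary`
+ ✓ `antisym_of_pattern_relations` ⇒ ✓ `ten_le_of_offDiag_relations` contradicts `|T| ≤ 9`; `E = 0` likewise; three proper T1 fibres ⇒
✓ `same_linear_divisor` ⇒ columns in `≤ 7` generators versus ✓ `offDiag_relations_fine` + ✓ `nine_le_of_offDiag_oneRel`.

No definitions, no `sorry`.  Honest framing: K1 ON THE STAR only (side-symmetric sector, pair splits, four splits with a hub); not a registered stub of
`LaplaceOptimalFive` — helper, closes nothing; `LaplaceOptimalFive` OPEN · CONTESTED 72/120; `VP ≠ VNP` NOT proved.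
-/

set_option linter.dupNamespace false

namespace Summit.ValiantsHypothesis.ValiantsHypothesis.Theorems.RigidityForcesSymmetryRankRigidMinimalRepr

namespace LaplaceFiveStar

open Finset MvPolynomial Module LaplaceFiveSectorSplit

variable {N : ℕ}

/-- **K1 on the star, main case**: labelled star, three two-term fibres `{p,a},{p,b},{p,c}`, at most nine terms — impossible
unless the weight is already `≥ 120`. [folklore] -/
theorem star_main (T : Finset (Fin N)) (S : Fin N → Finset (Fin 5))
    (u w : Fin N → (Fin 5 → Fin 5) → ℂ) (hdec : IsSplitDecomposition T S u w) (hsym : SideSymmetric T S u w)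
    (hpair : ∀ t ∈ T, (S t).card = 2) (hstar : ∃ c : Fin 5, ∀ A ∈ T.image S, c ∈ A)
    (p a b c d : Fin 5) (hpa : p ≠ a) (hpb : p ≠ b) (hpc : p ≠ c) (hpd : p ≠ d) (hab : a ≠ b) (hac : a ≠ c) (had : a ≠ d)
    (hbc : b ≠ c) (hbd : b ≠ d) (hcd : c ≠ d)
    (hI : T.image S = {({p, a} : Finset (Fin 5)), {p, b}, {p, c}, {p, d}})
    (htwoa : (T.filter (fun t => S t = {p, a})).card = 2) (htwob : (T.filter (fun t => S t = {p, b})).card = 2)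
    (htwoc : (T.filter (fun t => S t = {p, c})).card = 2) (hT9 : T.card ≤ 9) :
    Nat.factorial 5 ≤ laplaceWeight T S := by
  classical
  obtain ⟨U, W, hsymm, Ra, Rb, Rc, Rd, hrest⟩ :=
    star_letter_reading T S u w hdec hsym p a b c d hpa hpb hpc hpd hab hac had hbc hbd hcd hI
  simp only at hrest
  obtain ⟨hfib, hCa, hCb, hCc, hCd, hDb, hDc, hDd⟩ := hrest
  set Fa : Finset (Fin N) := T.filter (fun t => S t = {p, a}) with hFa
  set Fb : Finset (Fin N) := T.filter (fun t => S t = {p, b}) with hFb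
  set Fc : Finset (Fin N) := T.filter (fun t => S t = {p, c}) with hFc
  set Fd : Finset (Fin N) := T.filter (fun t => S t = {p, d}) with hFd
  have hFaT : Fa ⊆ T := Finset.filter_subset _ _
  have hFbT : Fb ⊆ T := Finset.filter_subset _ _
  have hFcT : Fc ⊆ T := Finset.filter_subset _ _
  have hFdT : Fd ⊆ T := Finset.filter_subset _ _
  have ne : ∀ x y : Fin 5, x ≠ y → p ≠ y → ({p, x} : Finset (Fin 5)) ≠ {p, y} := by
    intro x y hxy hpy h
    have hy : y ∈ ({p, x} : Finset (Fin 5)) := by rw [h]; simp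
    simp only [Finset.mem_insert, Finset.mem_singleton] at hy
    rcases hy with hy | hy
    · exact hpy hy.symm
    · exact hxy hy.symm
  have hsplit : ∀ f : Fin N → ℂ, ∑ t ∈ T, f t = (∑ t ∈ Fa, f t) + (∑ t ∈ Fb, f t) + (∑ t ∈ Fc, f t) + ∑ t ∈ Fd, f t := by
    intro f
    rw [← Finset.sum_fiberwise_of_maps_to (g := S) (fun t (ht : t ∈ T) => Finset.mem_image_of_mem S ht), hI,
      Finset.sum_insert, Finset.sum_insert, Finset.sum_insert, Finset.sum_singleton]
    · simp only [add_assoc]; rfl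
    · simp only [Finset.mem_singleton]; exact ne c d hcd hpd
    · simp only [Finset.mem_insert, Finset.mem_singleton, not_or]; exact ⟨ne b c hbc hpc, ne b d hbd hpd⟩
    · simp only [Finset.mem_insert, Finset.mem_singleton, not_or]; exact ⟨ne a b hab hpb, ne a c hac hpc, ne a d had hpd⟩
  have hcardT : T.card = Fa.card + Fb.card + Fc.card + Fd.card := by
    have h := hsplit (fun _ => 1)
    simp only [Finset.sum_const, nsmul_eq_mul, mul_one] at h
    exact_mod_cast h
  have hFd3 : Fd.card ≤ 3 := by rw [htwoa, htwob, htwoc] at hcardT; omega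
  have Hsym : ∀ (F : Finset (Fin N)), F ⊆ T →
      (∀ a b c d e : Fin 5, (∑ t ∈ F, U t a b * W t c d e) = ∑ t ∈ F, U t b a * W t c d e) ∧
      (∀ a b c d e : Fin 5, (∑ t ∈ F, U t a b * W t c d e) = ∑ t ∈ F, U t a b * W t d c e) ∧
      (∀ a b c d e : Fin 5, (∑ t ∈ F, U t a b * W t c d e) = ∑ t ∈ F, U t a b * W t c e d) := by
    intro F hF
    exact ⟨fun a b c d e => Finset.sum_congr rfl fun t ht => by rw [(hsymm t (hF ht)).1],
      fun a b c d e => Finset.sum_congr rfl fun t ht => by rw [(hsymm t (hF ht)).2.1],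
      fun a b c d e => Finset.sum_congr rfl fun t ht => by rw [(hsymm t (hF ht)).2.2]⟩
  obtain ⟨ha12, ha34, ha45⟩ := Hsym Fa hFaT
  obtain ⟨hb12, hb34, hb45⟩ := Hsym Fb hFbT
  obtain ⟨hc12, hc34, hc45⟩ := Hsym Fc hFcT
  obtain ⟨hd12, hd34, hd45⟩ := Hsym Fd hFdT
  set EL : Fin 5 → Fin 5 → Fin 5 → Fin 5 → Fin 5 → ℂ := fun A B C D E => (∑ t ∈ Fa, U t A B * W t C D E) - (1 / 10 : ℂ) *
    ((∑ t ∈ Fa, U t A B * W t C D E) + (∑ t ∈ Fa, U t A C * W t B D E) + (∑ t ∈ Fa, U t A D * W t B C E)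
      + (∑ t ∈ Fa, U t A E * W t B C D) + (∑ t ∈ Fa, U t B C * W t A D E) + (∑ t ∈ Fa, U t B D * W t A C E)
      + (∑ t ∈ Fa, U t B E * W t A C D) + (∑ t ∈ Fa, U t C D * W t A B E) + (∑ t ∈ Fa, U t C E * W t A B D)
      + (∑ t ∈ Fa, U t D E * W t A B C)) with hELdef
  have hELa : ∀ A B C D E : Fin 5, EL A B C D E = (∑ t ∈ Fa, U t A B * W t C D E) - (1 / 10 : ℂ) *
      ((∑ t ∈ Fa, U t A B * W t C D E) + (∑ t ∈ Fa, U t A C * W t B D E) + (∑ t ∈ Fa, U t A D * W t B C E)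
        + (∑ t ∈ Fa, U t A E * W t B C D) + (∑ t ∈ Fa, U t B C * W t A D E) + (∑ t ∈ Fa, U t B D * W t A C E)
        + (∑ t ∈ Fa, U t B E * W t A C D) + (∑ t ∈ Fa, U t C D * W t A B E) + (∑ t ∈ Fa, U t C E * W t A B D)
        + (∑ t ∈ Fa, U t D E * W t A B C)) := fun A B C D E => rfl
  have hELb : ∀ A B C D E : Fin 5, EL A B C D E = (∑ t ∈ Fb, U t A B * W t C D E) - (1 / 10 : ℂ) *
      ((∑ t ∈ Fb, U t A B * W t C D E) + (∑ t ∈ Fb, U t A C * W t B D E) + (∑ t ∈ Fb, U t A D * W t B C E)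
        + (∑ t ∈ Fb, U t A E * W t B C D) + (∑ t ∈ Fb, U t B C * W t A D E) + (∑ t ∈ Fb, U t B D * W t A C E)
        + (∑ t ∈ Fb, U t B E * W t A C D) + (∑ t ∈ Fb, U t C D * W t A B E) + (∑ t ∈ Fb, U t C E * W t A B D)
        + (∑ t ∈ Fb, U t D E * W t A B C)) := fun A B C D E =>
    (slack_eq_of_cross_symmetric (fun A B C D E => ∑ t ∈ Fa, U t A B * W t C D E)
      (fun A B C D E => ∑ t ∈ Fb, U t A B * W t C D E) ha12 ha34 ha45 hb12 hb34 hb45 hDb A B C D E).symm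
  have hELc : ∀ A B C D E : Fin 5, EL A B C D E = (∑ t ∈ Fc, U t A B * W t C D E) - (1 / 10 : ℂ) *
      ((∑ t ∈ Fc, U t A B * W t C D E) + (∑ t ∈ Fc, U t A C * W t B D E) + (∑ t ∈ Fc, U t A D * W t B C E)
        + (∑ t ∈ Fc, U t A E * W t B C D) + (∑ t ∈ Fc, U t B C * W t A D E) + (∑ t ∈ Fc, U t B D * W t A C E)
        + (∑ t ∈ Fc, U t B E * W t A C D) + (∑ t ∈ Fc, U t C D * W t A B E) + (∑ t ∈ Fc, U t C E * W t A B D)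
        + (∑ t ∈ Fc, U t D E * W t A B C)) := fun A B C D E =>
    (slack_eq_of_cross_symmetric (fun A B C D E => ∑ t ∈ Fa, U t A B * W t C D E)
      (fun A B C D E => ∑ t ∈ Fc, U t A B * W t C D E) ha12 ha34 ha45 hc12 hc34 hc45 hDc A B C D E).symm
  have hEL34 : ∀ A B C D E : Fin 5, EL A B C D E = EL A B D C E := fun A B C D E =>
    slack_symm34 (fun A B C D E => ∑ t ∈ Fa, U t A B * W t C D E) ha12 ha34 ha45 A B C D E
  have hEL45 : ∀ A B C D E : Fin 5, EL A B C D E = EL A B C E D := fun A B C D E =>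
    slack_symm45 (fun A B C D E => ∑ t ∈ Fa, U t A B * W t C D E) ha12 ha34 ha45 A B C D E
  have hcover : ∀ i : Fin 5, i = p ∨ i = a ∨ i = b ∨ i = c ∨ i = d := by
    have hc5 : ({p, a, b, c, d} : Finset (Fin 5)).card = 5 := by
      rw [Finset.card_insert_of_notMem, Finset.card_insert_of_notMem, Finset.card_insert_of_notMem,
        Finset.card_pair hcd]
      · simp [hbc, hbd]
      · simp [hab, hac, had]
      · simp [hpa, hpb, hpc, hpd]
    have huniv := Finset.eq_univ_of_card _ (by rw [hc5]; simp)
    intro i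
    have hi : i ∈ ({p, a, b, c, d} : Finset (Fin 5)) := by rw [huniv]; exact Finset.mem_univ i
    simpa using hi
  have hPd : ∀ A B C D E : Fin 5, (if Function.Injective (fun i : Fin 5 => if i = p then A else if i = a then B
      else if i = b then C else if i = c then D else E) then (1 : ℂ) else 0)
      = (if (A ≠ B ∧ A ≠ C ∧ A ≠ D ∧ A ≠ E ∧ B ≠ C ∧ B ≠ D ∧ B ≠ E ∧ C ≠ D ∧ C ≠ E ∧ D ≠ E) then (1 : ℂ) else 0) :=
    fun A B C D E => if_congr (word_injective_iff p a b c d hpa hpb hpc hpd hab hac had hbc hbd hcd hcover A B C D E) rfl rfl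
  have hslack : ∀ A B C D E : Fin 5, (∑ t ∈ T, U t A B * W t C D E)
      = (if (A ≠ B ∧ A ≠ C ∧ A ≠ D ∧ A ≠ E ∧ B ≠ C ∧ B ≠ D ∧ B ≠ E ∧ C ≠ D ∧ C ≠ E ∧ D ≠ E) then (1 : ℂ) else 0)
        + 4 * EL A B C D E := by
    intro A B C D E
    have h := star_slack_sum (fun A B C D E => ∑ t ∈ Fa, U t A B * W t C D E)
      (fun A B C D E => ∑ t ∈ Fb, U t A B * W t C D E) (fun A B C D E => ∑ t ∈ Fc, U t A B * W t C D E)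
      (fun A B C D E => ∑ t ∈ Fd, U t A B * W t C D E)
      (fun A B C D E => if Function.Injective (fun i : Fin 5 => if i = p then A else if i = a then B
        else if i = b then C else if i = c then D else E) then (1 : ℂ) else 0)
      ha12 ha34 ha45 hCa hc34 hd34 hd45 hDb hDc hDd hfib A B C D E
    rw [hsplit (fun t => U t A B * W t C D E), h, hPd]
  set Nk : Fin 5 → Fin 5 → (Fin 5 × Fin 5 × Fin 5) → ℂ := fun A B k => ∑ t ∈ T, U t A B * W t k.1 k.2.1 k.2.2 with hNk
  have hrelL : ∀ s : Fin 5 → Fin 5 → ℂ, (∀ k : Fin 5 × Fin 5 × Fin 5, ∑ A : Fin 5, ∑ B : Fin 5, s A B * Nk A B k = 0) →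
      ∀ c' d' e' : Fin 5, ∑ A : Fin 5, ∑ B : Fin 5, s A B *
        ((if (A ≠ B ∧ A ≠ c' ∧ A ≠ d' ∧ A ≠ e' ∧ B ≠ c' ∧ B ≠ d' ∧ B ≠ e' ∧ c' ≠ d' ∧ c' ≠ e' ∧ d' ≠ e') then (1 : ℂ) else 0)
          + 4 * EL A B c' d' e') = 0 := by
    intro s hs c' d' e'
    have h := hs (c', d', e')
    simp only [hNk, hslack] at h
    exact h
  let vT : Fin T.card → (Fin 5 → Fin 5 → ℂ) := fun i => U (T.equivFin.symm i).1
  have hcolT : ∀ k : Fin 5 × Fin 5 × Fin 5, (fun A B => Nk A B k) ∈ Submodule.span ℂ (Set.range vT) := by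
    intro k
    have h : (fun A B => Nk A B k) = ∑ t ∈ T, (W t k.1 k.2.1 k.2.2) • (U t : Fin 5 → Fin 5 → ℂ) := by
      funext A B
      simp only [hNk, Finset.sum_apply, Pi.smul_apply, smul_eq_mul]
      exact Finset.sum_congr rfl fun t _ => mul_comm _ _
    rw [h]
    refine Submodule.sum_mem _ fun t ht => Submodule.smul_mem _ _ (Submodule.subset_span ⟨T.equivFin ⟨t, ht⟩, ?_⟩)
    simp [vT]
  have ten_of_pattern : (∀ s : Fin 5 → Fin 5 → ℂ, (∀ k : Fin 5 × Fin 5 × Fin 5, ∑ A : Fin 5, ∑ B : Fin 5, s A B * Nk A B k = 0) →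
      ∀ c' d' e' : Fin 5, ∑ A : Fin 5, ∑ B : Fin 5, s A B *
        (if (A ≠ B ∧ A ≠ c' ∧ A ≠ d' ∧ A ≠ e' ∧ B ≠ c' ∧ B ≠ d' ∧ B ≠ e' ∧ c' ≠ d' ∧ c' ≠ e' ∧ d' ≠ e') then (1 : ℂ) else 0)
          = 0) → False := by
    intro hkill
    have h10 := ten_le_of_offDiag_relations Nk vT hcolT (fun s hs x y hxy => antisym_of_pattern_relations s (hkill s hs) x y hxy)
    omega
  have exitE0 : (∀ A B : Fin 5, (∑ c' : Fin 5, ∑ d' : Fin 5, ∑ e' : Fin 5, C (EL A B c' d' e') * X c' * X d' * X e'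
      : MvPolynomial (Fin 5) ℂ) = 0) → False := by
    intro h0
    have hEL0 : ∀ A B C D E : Fin 5, EL A B C D E = 0 := fun A B C D E =>
      cubic_tensor_eq_zero (fun C D E => EL A B C D E) (fun C D E => hEL34 A B C D E) (fun C D E => hEL45 A B C D E) (h0 A B) C D E
    refine ten_of_pattern fun s hs c' d' e' => ?_
    have h := hrelL s hs c' d' e'
    simp only [hEL0, mul_zero, add_zero] at h
    exact h
  have exitT2 : ∀ (t₁ t₂ : Fin N), t₁ ∈ T → t₂ ∈ T →
      (∀ A B C D E : Fin 5, EL A B C D E = (U t₁ A B * W t₁ C D E + U t₂ A B * W t₂ C D E) - (1 / 10 : ℂ) *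
        ((U t₁ A B * W t₁ C D E + U t₂ A B * W t₂ C D E) + (U t₁ A C * W t₁ B D E + U t₂ A C * W t₂ B D E)
        + (U t₁ A D * W t₁ B C E + U t₂ A D * W t₂ B C E) + (U t₁ A E * W t₁ B C D + U t₂ A E * W t₂ B C D)
        + (U t₁ B C * W t₁ A D E + U t₂ B C * W t₂ A D E) + (U t₁ B D * W t₁ A C E + U t₂ B D * W t₂ A C E)
        + (U t₁ B E * W t₁ A C D + U t₂ B E * W t₂ A C D) + (U t₁ C D * W t₁ A B E + U t₂ C D * W t₂ A B E)
        + (U t₁ C E * W t₁ A B D + U t₂ C E * W t₂ A B D) + (U t₁ D E * W t₁ A B C + U t₂ D E * W t₂ A B C))) →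
      (∃ e f : Fin 5 → ℂ,
        (∀ d' : Fin 5, (∃ s t : ℂ, ∀ x : Fin 5, U t₁ x d' = s * e x + t * f x) ∧ (∃ s t : ℂ, ∀ x : Fin 5, U t₂ x d' = s * e x + t * f x)) ∧
        (∀ v : Fin 5 → ℂ, ∑ x : Fin 5, v x * e x = 0 → ∑ x : Fin 5, v x * f x = 0 → ∀ b' c' : Fin 5, ∑ a' : Fin 5, v a' * W t₁ a' b' c' = 0) ∧
        (∀ v : Fin 5 → ℂ, ∑ x : Fin 5, v x * e x = 0 → ∑ x : Fin 5, v x * f x = 0 → ∀ b' c' : Fin 5, ∑ a' : Fin 5, v a' * W t₂ a' b' c' = 0)) →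
      False := by
    intro t₁ t₂ ht₁ ht₂ hELx ⟨e, f, hcol, hW1, hW2⟩
    obtain ⟨hU1, hW1a, hW1b⟩ := hsymm t₁ ht₁
    obtain ⟨hU2, hW2a, hW2b⟩ := hsymm t₂ ht₂
    have hann := slack_annihilated_of_binary (U t₁) (U t₂) (W t₁) (W t₂) hU1 hU2 hW1a hW1b hW2a hW2b e f hcol hW1 hW2
      (fun x y z w' u' => U t₁ x y * W t₁ z w' u' + U t₂ x y * W t₂ z w' u') (fun _ _ _ _ _ => rfl)
    refine ten_of_pattern fun s hs c' d' e' => ?_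
    refine relations_kill_pattern_of_binary
      (fun A B C D E => if (A ≠ B ∧ A ≠ C ∧ A ≠ D ∧ A ≠ E ∧ B ≠ C ∧ B ≠ D ∧ B ≠ E ∧ C ≠ D ∧ C ≠ E ∧ D ≠ E) then (1 : ℂ) else 0)
      EL (fun A B C D E => pattern_symm34 A B C D E) (fun A B C D E => pattern_symm45 A B C D E)
      (fun A B C E => pattern_rep A B C E) e f (fun v hve hvf A B D E' => ?_) 4 s (hrelL s hs) c' d' e'
    have h := hann v hve hvf A B D E'
    simp only [← hELx] at h
    exact h
  obtain ⟨ta1, ta2, hta, hFae⟩ := Finset.card_eq_two.mp htwoa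
  obtain ⟨tb1, tb2, htb, hFbe⟩ := Finset.card_eq_two.mp htwob
  obtain ⟨tc1, tc2, htc, hFce⟩ := Finset.card_eq_two.mp htwoc
  have hta1 : ta1 ∈ T := hFaT (by rw [hFae]; simp)
  have hta2 : ta2 ∈ T := hFaT (by rw [hFae]; simp)
  have htb1 : tb1 ∈ T := hFbT (by rw [hFbe]; simp)
  have htb2 : tb2 ∈ T := hFbT (by rw [hFbe]; simp)
  have htc1 : tc1 ∈ T := hFcT (by rw [hFce]; simp)
  have htc2 : tc2 ∈ T := hFcT (by rw [hFce]; simp)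
  set Epoly : Fin 5 → Fin 5 → MvPolynomial (Fin 5) ℂ :=
    fun A B => ∑ c' : Fin 5, ∑ d' : Fin 5, ∑ e' : Fin 5, C (EL A B c' d' e') * X c' * X d' * X e' with hEpolydef
  have hEpoly : ∀ A B : Fin 5, Epoly A B = ∑ c' : Fin 5, ∑ d' : Fin 5, ∑ e' : Fin 5, C (EL A B c' d' e') * X c' * X d' * X e' :=
    fun A B => rfl
  obtain ⟨paira, hC33a, hEa⟩ := fibre_inputs T Fa hFaT U W hsymm ta1 ta2 hta hFae hCa EL hELa Epoly hEpoly
  obtain ⟨pairb, hC33b, hEb⟩ := fibre_inputs T Fb hFbT U W hsymm tb1 tb2 htb hFbe hCb EL hELb Epoly hEpoly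
  obtain ⟨pairc, hC33c, hEc⟩ := fibre_inputs T Fc hFcT U W hsymm tc1 tc2 htc hFce hCc EL hELc Epoly hEpoly
  have hELpa : ∀ A B C D E : Fin 5, EL A B C D E = (U ta1 A B * W ta1 C D E + U ta2 A B * W ta2 C D E) - (1 / 10 : ℂ) *
      ((U ta1 A B * W ta1 C D E + U ta2 A B * W ta2 C D E) + (U ta1 A C * W ta1 B D E + U ta2 A C * W ta2 B D E)
      + (U ta1 A D * W ta1 B C E + U ta2 A D * W ta2 B C E) + (U ta1 A E * W ta1 B C D + U ta2 A E * W ta2 B C D)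
      + (U ta1 B C * W ta1 A D E + U ta2 B C * W ta2 A D E) + (U ta1 B D * W ta1 A C E + U ta2 B D * W ta2 A C E)
      + (U ta1 B E * W ta1 A C D + U ta2 B E * W ta2 A C D) + (U ta1 C D * W ta1 A B E + U ta2 C D * W ta2 A B E)
      + (U ta1 C E * W ta1 A B D + U ta2 C E * W ta2 A B D) + (U ta1 D E * W ta1 A B C + U ta2 D E * W ta2 A B C)) :=
    fun A B C D E => by rw [hELa]; simp only [paira]
  have hELpb : ∀ A B C D E : Fin 5, EL A B C D E = (U tb1 A B * W tb1 C D E + U tb2 A B * W tb2 C D E) - (1 / 10 : ℂ) *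
      ((U tb1 A B * W tb1 C D E + U tb2 A B * W tb2 C D E) + (U tb1 A C * W tb1 B D E + U tb2 A C * W tb2 B D E)
      + (U tb1 A D * W tb1 B C E + U tb2 A D * W tb2 B C E) + (U tb1 A E * W tb1 B C D + U tb2 A E * W tb2 B C D)
      + (U tb1 B C * W tb1 A D E + U tb2 B C * W tb2 A D E) + (U tb1 B D * W tb1 A C E + U tb2 B D * W tb2 A C E)
      + (U tb1 B E * W tb1 A C D + U tb2 B E * W tb2 A C D) + (U tb1 C D * W tb1 A B E + U tb2 C D * W tb2 A B E)
      + (U tb1 C E * W tb1 A B D + U tb2 C E * W tb2 A B D) + (U tb1 D E * W tb1 A B C + U tb2 D E * W tb2 A B C)) :=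
    fun A B C D E => by rw [hELb]; simp only [pairb]
  have hELpc : ∀ A B C D E : Fin 5, EL A B C D E = (U tc1 A B * W tc1 C D E + U tc2 A B * W tc2 C D E) - (1 / 10 : ℂ) *
      ((U tc1 A B * W tc1 C D E + U tc2 A B * W tc2 C D E) + (U tc1 A C * W tc1 B D E + U tc2 A C * W tc2 B D E)
      + (U tc1 A D * W tc1 B C E + U tc2 A D * W tc2 B C E) + (U tc1 A E * W tc1 B C D + U tc2 A E * W tc2 B C D)
      + (U tc1 B C * W tc1 A D E + U tc2 B C * W tc2 A D E) + (U tc1 B D * W tc1 A C E + U tc2 B D * W tc2 A C E)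
      + (U tc1 B E * W tc1 A C D + U tc2 B E * W tc2 A C D) + (U tc1 C D * W tc1 A B E + U tc2 C D * W tc2 A B E)
      + (U tc1 C E * W tc1 A B D + U tc2 C E * W tc2 A B D) + (U tc1 D E * W tc1 A B C + U tc2 D E * W tc2 A B C)) :=
    fun A B C D E => by rw [hELc]; simp only [pairc]
  have hma : ({p, a} : Finset (Fin 5)) ∈ T.image S := by rw [hI]; simp
  have hmb : ({p, b} : Finset (Fin 5)) ∈ T.image S := by rw [hI]; simp
  have hmc : ({p, c} : Finset (Fin 5)) ∈ T.image S := by rw [hI]; simp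
  have hsha : ∀ v : Fin 5 → Fin 5, (∑ t ∈ T.filter (fun t => S t = {p, a}), u t v * w t v)
      = U ta1 (v p) (v a) * W ta1 (v b) (v c) (v d) + U ta2 (v p) (v a) * W ta2 (v b) (v c) (v d) := by
    intro v
    rw [← paira]
    exact Finset.sum_congr rfl fun t ht => by
      obtain ⟨htT, hSt⟩ := Finset.mem_filter.mp ht
      rw [(Ra t htT hSt v).1, (Ra t htT hSt v).2]
  have hshb : ∀ v : Fin 5 → Fin 5, (∑ t ∈ T.filter (fun t => S t = {p, b}), u t v * w t v)
      = U tb1 (v p) (v b) * W tb1 (v a) (v c) (v d) + U tb2 (v p) (v b) * W tb2 (v a) (v c) (v d) := by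
    intro v
    rw [← pairb]
    exact Finset.sum_congr rfl fun t ht => by
      obtain ⟨htT, hSt⟩ := Finset.mem_filter.mp ht
      rw [(Rb t htT hSt v).1, (Rb t htT hSt v).2]
  have hshc : ∀ v : Fin 5 → Fin 5, (∑ t ∈ T.filter (fun t => S t = {p, c}), u t v * w t v)
      = U tc1 (v p) (v c) * W tc1 (v a) (v b) (v d) + U tc2 (v p) (v c) * W tc2 (v a) (v b) (v d) := by
    intro v
    rw [← pairc]
    exact Finset.sum_congr rfl fun t ht => by
      obtain ⟨htT, hSt⟩ := Finset.mem_filter.mp ht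
      rw [(Rc t htT hSt v).1, (Rc t htT hSt v).2]
  obtain ⟨hUa1, hWa1a, hWa1b⟩ := hsymm ta1 hta1
  obtain ⟨hUa2, hWa2a, hWa2b⟩ := hsymm ta2 hta2
  obtain ⟨hUb1, hWb1a, hWb1b⟩ := hsymm tb1 htb1
  obtain ⟨hUb2, hWb2a, hWb2b⟩ := hsymm tb2 htb2
  obtain ⟨hUc1, hWc1a, hWc1b⟩ := hsymm tc1 htc1
  obtain ⟨hUc2, hWc2a, hWc2b⟩ := hsymm tc2 htc2
  rcases two_term_engine (U ta1) (U ta2) (W ta1) (W ta2) hUa1 hUa2 hWa1a hWa1b hWa2a hWa2b hC33a Epoly hEa with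
    ⟨Uc, Wc, hUc, hWc1, hWc2, hpt, hCU⟩ | hT2 | hE0 | ⟨la, za, Ua, a2a, Va, hza, ha2a, hUas, ⟨αa, βa, γa, δa, hcolsa⟩, h40a, hshapea⟩
  · exact weight_of_closed_product T S u w hdec hsym hpair hstar {p, a} hma p a b c d hpa hpb hab hac had hbc hbd rfl Uc Wc
      hUc hWc1 hWc2 hCU (fun v => by rw [hsha, hpt])
  · exact (exitT2 ta1 ta2 hta1 hta2 hELpa hT2).elim
  · exact (exitE0 hE0).elim
  rcases two_term_engine (U tb1) (U tb2) (W tb1) (W tb2) hUb1 hUb2 hWb1a hWb1b hWb2a hWb2b hC33b Epoly hEb with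
    ⟨Uc, Wc, hUc, hWc1, hWc2, hpt, hCU⟩ | hT2 | hE0 | ⟨lb, zb, Ub, a2b, Vb, hzb, ha2b, hUbs, ⟨αb, βb, γb, δb, hcolsb⟩, h40b, hshapeb⟩
  · exact weight_of_closed_product T S u w hdec hsym hpair hstar {p, b} hmb p b a c d hpb hpa (Ne.symm hab) hbc hbd hac had rfl
      Uc Wc hUc hWc1 hWc2 hCU (fun v => by rw [hshb, hpt])
  · exact (exitT2 tb1 tb2 htb1 htb2 hELpb hT2).elim
  · exact (exitE0 hE0).elim
  rcases two_term_engine (U tc1) (U tc2) (W tc1) (W tc2) hUc1 hUc2 hWc1a hWc1b hWc2a hWc2b hC33c Epoly hEc with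
    ⟨Uc, Wc, hUc, hWc1, hWc2, hpt, hCU⟩ | hT2 | hE0 | ⟨lc, zc, Ucc, a2c, Vc, hzc, ha2c, hUcs, ⟨αc, βc, γc, δc, hcolsc⟩, h40c, hshapec⟩
  · exact weight_of_closed_product T S u w hdec hsym hpair hstar {p, c} hmc p c a b d hpc hpa (Ne.symm hac) (Ne.symm hbc) hcd hab
      had rfl Uc Wc hUc hWc1 hWc2 hCU (fun v => by rw [hshc, hpt])
  · exact (exitT2 tc1 tc2 htc1 htc2 hELpc hT2).elim
  · exact (exitE0 hE0).elim
  set La : MvPolynomial (Fin 5) ℂ := ∑ z : Fin 5, la z • (X z : MvPolynomial (Fin 5) ℂ) with hLa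
  set Lb : MvPolynomial (Fin 5) ℂ := ∑ z : Fin 5, lb z • (X z : MvPolynomial (Fin 5) ℂ) with hLb
  set Lc : MvPolynomial (Fin 5) ℂ := ∑ z : Fin 5, lc z • (X z : MvPolynomial (Fin 5) ℂ) with hLc
  set Qa : MvPolynomial (Fin 5) ℂ := ∑ x : Fin 5, ∑ w : Fin 5, C (Ua x w) * X x * X w with hQa
  have h40ne : (40 : MvPolynomial (Fin 5) ℂ) ≠ 0 := by
    rw [show (40 : MvPolynomial (Fin 5) ℂ) = C (40 : ℂ) from (map_ofNat C 40).symm, Ne, C_eq_zero]; norm_num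
  have hunit : IsUnit (15 * C a2a : MvPolynomial (Fin 5) ℂ) := by
    rw [show (15 : MvPolynomial (Fin 5) ℂ) = C (15 : ℂ) from (map_ofNat C 15).symm, ← map_mul]
    exact (isUnit_iff_ne_zero.mpr (mul_ne_zero (by norm_num) ha2a)).map C
  have hdvd : ∀ (L' : MvPolynomial (Fin 5) ℂ), (∀ A B : Fin 5, L' ∣ Epoly A B) → ∀ A B : Fin 5,
      L' ∣ La * (2 * La ^ 2 * C (Ua A B) - La * (C (la A) * pderiv B Qa + C (la B) * pderiv A Qa) + 2 * C (la A * la B) * Qa) := by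
    intro L' hL' A B
    have h2 : L' ∣ 40 * Epoly A B := Dvd.dvd.mul_left (hL' A B) _
    rw [h40a A B, show (15 * C a2a * La * (2 * La ^ 2 * C (Ua A B) - La * (C (la A) * pderiv B Qa + C (la B) * pderiv A Qa)
      + 2 * C (la A * la B) * Qa) : MvPolynomial (Fin 5) ℂ) = (15 * C a2a) * (La * (2 * La ^ 2 * C (Ua A B)
      - La * (C (la A) * pderiv B Qa + C (la B) * pderiv A Qa) + 2 * C (la A * la B) * Qa)) by ring] at h2
    exact (IsUnit.dvd_mul_left hunit).mp h2
  have hdegen : (∃ m : Fin 5 → ℂ, ∀ x y : Fin 5, Ua x y = la x * m y + m x * la y) → False := by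
    rintro ⟨m, hm⟩
    refine exitE0 fun A B => ?_
    have hG : (2 * La ^ 2 * C (Ua A B) - La * (C (la A) * pderiv B Qa + C (la B) * pderiv A Qa) + 2 * C (la A * la B) * Qa
        : MvPolynomial (Fin 5) ℂ) = 0 := G_eq_zero_of_degenerate la m Ua hm A B
    have h := h40a A B
    rw [hG, mul_zero] at h
    exact (mul_eq_zero.mp h).resolve_left h40ne
  have hLb_dvd : ∀ A B : Fin 5, Lb ∣ Epoly A B := fun A B =>
    ⟨C (3 * a2b / 4 * (lb A * lb B)) * (∑ x : Fin 5, ∑ w : Fin 5, C (Ub x w) * X x * X w) + Lb * Vb A B, by rw [hshapeb A B]; ring⟩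
  have hLc_dvd : ∀ A B : Fin 5, Lc ∣ Epoly A B := fun A B =>
    ⟨C (3 * a2c / 4 * (lc A * lc B)) * (∑ x : Fin 5, ∑ w : Fin 5, C (Ucc x w) * X x * X w) + Lc * Vc A B, by rw [hshapec A B]; ring⟩
  obtain ⟨tb, htb'⟩ : ∃ t : ℂ, ∀ z : Fin 5, lb z = t * la z := by
    rcases same_linear_divisor la lb za hza Ua hUas Qa (hdvd Lb hLb_dvd) with h | h
    · exact h
    · exact (hdegen h).elim
  obtain ⟨tc, htc'⟩ : ∃ t : ℂ, ∀ z : Fin 5, lc z = t * la z := by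
    rcases same_linear_divisor la lc za hza Ua hUas Qa (hdvd Lc hLc_dvd) with h | h
    · exact h
    · exact (hdegen h).elim
  let v7 : Fin (4 + Fd.card) → (Fin 5 → Fin 5 → ℂ) :=
    Fin.append ![fun x y => la x * la y, Ua, Ub, Ucc] (fun i => U (Fd.equivFin.symm i).1)
  have hv0 : (fun x y => la x * la y) ∈ Submodule.span ℂ (Set.range v7) :=
    Submodule.subset_span ⟨Fin.castAdd Fd.card 0, by simp [v7]⟩
  have hv1 : Ua ∈ Submodule.span ℂ (Set.range v7) := Submodule.subset_span ⟨Fin.castAdd Fd.card 1, by simp [v7]⟩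
  have hv2 : Ub ∈ Submodule.span ℂ (Set.range v7) := Submodule.subset_span ⟨Fin.castAdd Fd.card 2, by simp [v7]⟩
  have hv3 : Ucc ∈ Submodule.span ℂ (Set.range v7) := Submodule.subset_span ⟨Fin.castAdd Fd.card 3, by simp [v7]⟩
  have memT1 : ∀ (Ut : Fin 5 → Fin 5 → ℂ) (μ : Fin 5 → ℂ) (tμ α β : ℂ) (U'' : Fin 5 → Fin 5 → ℂ),
      (∀ z : Fin 5, μ z = tμ * la z) → U'' ∈ Submodule.span ℂ (Set.range v7) →
      (∀ x y : Fin 5, Ut x y = α * (μ x * μ y) + β * U'' x y) → Ut ∈ Submodule.span ℂ (Set.range v7) := by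
    intro Ut μ tμ α β U'' hμ hU'' hUt
    have h : Ut = (α * tμ ^ 2) • (fun x y => la x * la y) + β • U'' := by
      funext x y
      simp only [Pi.add_apply, Pi.smul_apply, smul_eq_mul, hUt, hμ]
      ring
    rw [h]
    exact Submodule.add_mem _ (Submodule.smul_mem _ _ hv0) (Submodule.smul_mem _ _ hU'')
  have hone : ∀ z : Fin 5, la z = 1 * la z := fun z => (one_mul _).symm
  have hcol7 : ∀ k : Fin 5 × Fin 5 × Fin 5, (fun A B => Nk A B k) ∈ Submodule.span ℂ (Set.range v7) := by
    intro k
    have h : (fun A B => Nk A B k) = (∑ t ∈ Fa, (W t k.1 k.2.1 k.2.2) • (U t : Fin 5 → Fin 5 → ℂ))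
        + (∑ t ∈ Fb, (W t k.1 k.2.1 k.2.2) • (U t : Fin 5 → Fin 5 → ℂ)) + (∑ t ∈ Fc, (W t k.1 k.2.1 k.2.2) • (U t : Fin 5 → Fin 5 → ℂ))
        + (∑ t ∈ Fd, (W t k.1 k.2.1 k.2.2) • (U t : Fin 5 → Fin 5 → ℂ)) := by
      funext A B
      simp only [hNk, Finset.sum_apply, Pi.add_apply, Pi.smul_apply, smul_eq_mul]
      rw [hsplit (fun t => U t A B * W t k.1 k.2.1 k.2.2)]
      simp only [mul_comm]
    rw [h, hFae, hFbe, hFce, Finset.sum_pair hta, Finset.sum_pair htb, Finset.sum_pair htc]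
    refine Submodule.add_mem _ (Submodule.add_mem _ (Submodule.add_mem _ ?_ ?_) ?_) ?_
    · exact Submodule.add_mem _
        (Submodule.smul_mem _ _ (memT1 _ la 1 αa βa Ua hone hv1 (fun x y => (hcolsa x y).1)))
        (Submodule.smul_mem _ _ (memT1 _ la 1 γa δa Ua hone hv1 (fun x y => (hcolsa x y).2)))
    · exact Submodule.add_mem _
        (Submodule.smul_mem _ _ (memT1 _ lb tb αb βb Ub htb' hv2 (fun x y => (hcolsb x y).1)))
        (Submodule.smul_mem _ _ (memT1 _ lb tb γb δb Ub htb' hv2 (fun x y => (hcolsb x y).2)))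
    · exact Submodule.add_mem _
        (Submodule.smul_mem _ _ (memT1 _ lc tc αc βc Ucc htc' hv3 (fun x y => (hcolsc x y).1)))
        (Submodule.smul_mem _ _ (memT1 _ lc tc γc δc Ucc htc' hv3 (fun x y => (hcolsc x y).2)))
    · refine Submodule.sum_mem _ fun t ht => Submodule.smul_mem _ _ (Submodule.subset_span ⟨Fin.natAdd 4 (Fd.equivFin ⟨t, ht⟩), ?_⟩)
      simp [v7]
  obtain ⟨wf, hwf⟩ := offDiag_relations_fine la za hza Qa (a2a / 2)
  have hshape' : ∀ A B : Fin 5, C (2 / 3 : ℂ) * Epoly A B = C (a2a / 2 * (la A * la B)) * La * Qa + La ^ 2 * (C (2 / 3 : ℂ) * Va A B) := by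
    intro A B
    have key : (C (2 / 3 : ℂ) : MvPolynomial (Fin 5) ℂ) * C (3 * a2a / 4 * (la A * la B)) = C (a2a / 2 * (la A * la B)) := by
      rw [← map_mul]
      congr 1
      ring
    rw [hshapea, mul_add, ← mul_assoc, ← mul_assoc, key]
    ring
  have hrelF : ∀ s : Fin 5 → Fin 5 → ℂ, (∀ k : Fin 5 × Fin 5 × Fin 5, ∑ A : Fin 5, ∑ B : Fin 5, s A B * Nk A B k = 0) →
      ∀ A B : Fin 5, A ≠ B → s A B + s B A = (∑ x : Fin 5, ∑ y : Fin 5, s x y * (la x * la y)) * wf A B :=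
    fun s hs => hwf (fun A B => C (2 / 3 : ℂ) * Epoly A B) (fun A B => C (2 / 3 : ℂ) * Va A B) hshape' s
      (poly_relation_of_letter_relation s EL Epoly hEpoly (hrelL s hs))
  by_cases hw0 : ∃ a₀ b₀ : Fin 5, a₀ ≠ b₀ ∧ wf a₀ b₀ ≠ 0
  · obtain ⟨a₀, b₀, h₀, hw⟩ := hw0
    have h9 := nine_le_of_offDiag_oneRel Nk v7 hcol7 wf a₀ b₀ hw
      (fun s hs A B hAB => oneRel_shape_of_fine wf s _ (hrelF s hs) a₀ b₀ h₀ A B hAB)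
    omega
  · have hw0' : ∀ a₀ b₀ : Fin 5, a₀ ≠ b₀ → wf a₀ b₀ = 0 := by
      intro a₀ b₀ h
      by_contra hne
      exact hw0 ⟨a₀, b₀, h, hne⟩
    have h10 := ten_le_of_offDiag_relations Nk v7 hcol7
      (fun s hs A B hAB => by rw [hrelF s hs A B hAB, hw0' A B hAB, mul_zero])
    omega

end LaplaceFiveStar

end Summit.ValiantsHypothesis.ValiantsHypothesis.Theorems.RigidityForcesSymmetryRankRigidMinimalRepr
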